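import Summits.ResolutionOfSingularities.ResolutionOfSingularities.Theorems.LossEpisode
import HarnessLib

/-!
# LossEpisode2 — the loss episode automaton, slice 2 (§5–§7 of `g28/LossEpisode.lean`: after-loss dichotomy, the path theorem,
the located residual reduced to `NoRunStateOnTail`)

decomp-res-lens-3, gen 28; imports slice 1 `Theorems.LossEpisode` (§1–§4).  See the module docstring of slice 1.
-/

open MvPolynomial Finset
open Literature.AlgebraicGeometry.Resolution
open Literature.AlgebraicGeometry.Resolution.Hauser2010
open Literature.AlgebraicGeometry.Resolution.PointBlowup
open Summit.ResolutionOfSingularities.ResolutionOfSingularities.Theorems.TightDefectClasses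
open Summit.ResolutionOfSingularities.ResolutionOfSingularities.Theorems.TightDefectStrongWalks
open Summit.ResolutionOfSingularities.ResolutionOfSingularities.Theorems.ItineraryCutClasses
open Summit.ResolutionOfSingularities.ResolutionOfSingularities.Theorems.BoundaryLedger
open Summit.ResolutionOfSingularities.ResolutionOfSingularities.Theorems.ProximityCut
open Summit.ResolutionOfSingularities.ResolutionOfSingularities.Theorems.ConeCut
open Summit.ResolutionOfSingularities.ResolutionOfSingularities.Theorems.WallCut
open Summit.ResolutionOfSingularities.ResolutionOfSingularities.Theorems.WallCutCritical
open Summit.ResolutionOfSingularities.ResolutionOfSingularities.Theorems.LossIsFatal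
open Summit.ResolutionOfSingularities.ResolutionOfSingularities.Theorems.LossIsFatalLayer
open Summit.ResolutionOfSingularities.ResolutionOfSingularities.Theorems.LossIsFatalLedger
open Summit.ResolutionOfSingularities.ResolutionOfSingularities.Theorems.LossExitCone

namespace Summit.ResolutionOfSingularities.ResolutionOfSingularities.Theorems.LossEpisode

variable {K : Type} [Field K] [DecidableEq K] {q : ℕ} {s₀ : State (Fin 3) K}

/-! ## §5 After a total loss: another (smaller) loss, or a repeat and a run state -/

section LossNext

variable {W : ForcedWalk q s₀} {N s : ℕ}

/-- **AFTER A TOTAL LOSS (PROVED).**  After a total loss at `t ≥ N` on the tail, `ordZero F_t = q + T`, `r_{t+1} = T·e_{j_t}`,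
`q < T + s`, and either move `t+1` is NOT a proximity repeat — then it is again a total loss, with the strictly smaller mass
`T + s − q < T` — or it is a proximity repeat and `t + 2` is a run state `(j_{t+1}, j_t, l; d, T)`, `T + s = q + d`.
[`loss_consecutive`, `loss_data`, `runState_of_stays_loss`] [new] [folklore] -/
theorem lossMove_next (hroot : IsRoot q s₀) (hT : TailHyp W N s) {t : ℕ} (hNt : N ≤ t) (hloss : IsLossMove W t) :
    ∃ T : ℕ, ordZero (W.st t).F = ((q + T : ℕ) : ℕ∞) ∧ 1 ≤ T ∧ (W.st (t + 1)).r = Finsupp.single (W.j t) T ∧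
      q < T + s ∧
      ( (¬ StaysOnNewest W t ∧ IsLossMove W (t + 1) ∧
          (W.st (t + 2)).r = Finsupp.single (W.j (t + 1)) (T + s - q)) ∨
        (StaysOnNewest W t ∧ ∃ l : Fin 3, ∃ d : ℕ, l ≠ W.j (t + 1) ∧ l ≠ W.j t ∧ T + s = q + d ∧ 1 ≤ d ∧
          IsRunState W s (t + 2) (W.j (t + 1)) (W.j t) l d T) ) := by
  classical
  have hsh0 := hT.shade t hNt
  have hsh1 := hT.shade (t + 1) (by omega)
  have hsh2 := hT.shade (t + 2) (by omega)
  have hne := hT.ne_q t hNt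
  have hne1 := hT.ne_q (t + 1) (by omega)
  obtain ⟨T, hot, hot1, h1T, -, -, hr1⟩ := loss_data hroot W t hsh0 hsh1 hloss hne
  obtain ⟨o₁, ho₁, hqo₁⟩ := walk_nat hroot W (t + 1)
  have ho₁' : o₁ = s + T := by have h := ho₁.symm.trans hot1; exact_mod_cast h
  have ho₁q : o₁ ≠ q := fun h => hne1 (by rw [ho₁, h])
  have hqT : q < T + s := by omega
  refine ⟨T, hot, h1T, hr1, hqT, ?_⟩
  by_cases hst : StaysOnNewest W t
  · right
    obtain ⟨l, T', d, hli, hlj, hot', hr1', hTs, h1d, hS⟩ := runState_of_stays_loss hroot hT hNt hloss hst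
    have hTT : T' = T := by
      have h := hot'.symm.trans hot
      have h' : q + T' = q + T := by exact_mod_cast h
      omega
    subst hTT
    exact ⟨hst, l, d, hli, hlj, hTs, h1d, hS⟩
  · left
    have hloss' : IsLossMove W (t + 1) := loss_consecutive hroot W t hsh0 hsh1 hloss hne hst
    obtain ⟨T₂, hot₂, -, -, -, -, hr2⟩ := loss_data hroot W (t + 1) hsh1 hsh2 hloss' hne1
    have hT₂ : T₂ = T + s - q := by
      have h := hot₂.symm.trans hot1
      have h' : q + T₂ = s + T := by exact_mod_cast h
      omega
    refine ⟨hst, hloss', ?_⟩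
    rw [← hT₂]; exact hr2

end LossNext

/-! ## §6 The tail is a path in the automaton -/

section Path

variable {W : ForcedWalk q s₀} {N s : ℕ}

/-- **THE TAIL IS A PATH IN THE AUTOMATON (PROVED).**  After a total loss at `t ≥ N` on the tail, every later stage `t + n`
is one of: a LOSS stage (move `t+n` is a total loss), a REPEAT stage (move `t+n−1` was a total loss and a proximity repeat
follows it), or a RUN stage (`IsRunState` with some roles and masses). [new] [folklore] -/
theorem tail_sorts (hroot : IsRoot q s₀) (hT : TailHyp W N s) {t : ℕ} (hNt : N ≤ t) (hloss : IsLossMove W t) (n : ℕ) :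
    IsLossMove W (t + n) ∨
      (∃ t' : ℕ, t' + 1 = t + n ∧ N ≤ t' ∧ IsLossMove W t' ∧ StaysOnNewest W t') ∨
      (∃ i j l : Fin 3, ∃ k m : ℕ, IsRunState W s (t + n) i j l k m) := by
  induction n with
  | zero => exact Or.inl (by simpa using hloss)
  | succ n ih =>
    rcases ih with hL | ⟨t', ht', hNt', hL', hst'⟩ | ⟨i, j, l, k, m, hS⟩
    · obtain ⟨T, -, -, -, -, hnext⟩ := lossMove_next hroot hT (by omega) hL
      rcases hnext with ⟨-, hL1, -⟩ | ⟨hst, -⟩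
      · exact Or.inl (by rw [← add_assoc]; exact hL1)
      · exact Or.inr (Or.inl ⟨t + n, by omega, by omega, hL, hst⟩)
    · obtain ⟨l, T, d, -, -, -, -, -, -, hS⟩ := runState_of_stays_loss hroot hT hNt' hL' hst'
      refine Or.inr (Or.inr ⟨W.j (t' + 1), W.j t', l, d, T, ?_⟩)
      have h : t' + 2 = t + (n + 1) := by omega
      rw [← h]; exact hS
    · obtain ⟨-, -, -, hnext⟩ := runState_next hroot hT (by omega) hS
      rcases hnext with ⟨-, -, hS'⟩ | ⟨-, -, hS'⟩ | ⟨-, -, -, hS'⟩ | ⟨-, hL, -⟩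
      · exact Or.inr (Or.inr ⟨i, j, l, _, _, by rw [← add_assoc]; exact hS'⟩)
      · exact Or.inr (Or.inr ⟨i, j, l, _, _, by rw [← add_assoc]; exact hS'⟩)
      · exact Or.inr (Or.inr ⟨i, l, j, _, _, by rw [← add_assoc]; exact hS'⟩)
      · obtain ⟨T, -, -, -, -, hnext'⟩ := lossMove_next hroot hT (by omega) hL
        rcases hnext' with ⟨-, hL1, -⟩ | ⟨hst, -⟩
        · exact Or.inl (by rw [← add_assoc]; exact hL1)
        · exact Or.inr (Or.inl ⟨t + n, by omega, by omega, hL, hst⟩)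

end Path

/-! ## §7 The automaton form of the located residual's open core -/

/-- **NO RUN STATE ON A LOSSY TAIL** — the automaton form of `LossIsFatalStaysDeep` (hence of (W1) and of the located
residual `WallCut.NoLossyStrictTailsDeep`): no forced walk whose tail from `N` on satisfies the common hypothesis block
(`TailHyp`), is translated infinitely often and meets every letter infinitely often, has a RUN STATE at a stage `u ≥ N`.
This is the statement on which the episode measure (`episode_measure_lt`, (B′) of the window) is to be proved; the binders
are the residual's own, repackaged.  OPEN. [new] -/
def NoRunStateOnTail : Prop :=
  ∀ p : ℕ, p.Prime → ∀ e : ℕ, 2 ≤ e → ∀ (K : Type) [Field K] [CharP K p] [PerfectField K] [DecidableEq K]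
    (s₀ : State (Fin 3) K), IsRoot (p ^ e) s₀ → ∀ W : ForcedWalk (p ^ e) s₀, ∀ N s : ℕ, TailHyp W N s →
    (∀ M : ℕ, ∃ t, M ≤ t ∧ W.b t ≠ 0) → (∀ (k : Fin 3) (N' : ℕ), ∃ t, N' ≤ t ∧ (W.j t = k ∨ W.b t k ≠ 0)) →
    ∀ u : ℕ, N ≤ u → ∀ (i j l : Fin 3) (k m : ℕ), IsRunState W s u i j l k m → False

/-- The common hypothesis block, extracted from the binders of `LossIsFatalStaysDeep`. [new] [folklore] -/
theorem tailHyp_of_binders {p e : ℕ} {s₀ : State (Fin 3) K} (W : ForcedWalk (p ^ e) s₀) {N s : ℕ}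
    (hplat : ∀ t, N ≤ t → (W.st (t + 1)).shade = (W.st t).shade)
    (hne : ∀ t, N ≤ t → ordZero (W.st t).F ≠ ((p ^ e : ℕ) : ℕ∞)) (hsN : (W.st N).shade = (s : ℕ∞)) (h3 : 3 ≤ s)
    (hlt : s < p ^ e) (hsmall : ∀ t, N ≤ t → ∀ y, (W.st t).r y + 1 ≤ s) : TailHyp W N s :=
  ⟨shade_eq_of_plateau W hplat hsN, hne, hsmall, by omega, hlt⟩

/-- **REDUCTION (PROVED, hypothesis-free): the automaton form implies the stays form** — a total loss at `t ≥ N` followed by a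
proximity repeat produces a run state at `t + 2` (`runState_of_stays_loss`). [new] [folklore] -/
theorem lossIsFatalStaysDeep_of_noRunStateOnTail (h : NoRunStateOnTail) : LossIsFatalStaysDeep := by
  intro p hp e he K _ _ _ _ s₀ hroot W hpos N hplat hne hS hb s hsN h3 h33 h22 hlt hcoord hsd t hNt hloss hst
  have hT : TailHyp W N s := tailHyp_of_binders W hplat hne hsN h3 hlt (fun t ht => (hsd t ht).1)
  obtain ⟨l, T, d, -, -, -, -, -, -, hRS⟩ := runState_of_stays_loss hroot hT hNt hloss hst
  exact h p hp e he K s₀ hroot W N s hT hb hcoord (t + 2) (by omega) _ _ _ _ _ hRS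

/-- **… hence (W1) and the located residual** (`LossIsFatalLedger` assemblies). [new] [folklore] -/
theorem noLossyStrictTailsDeep_of_noRunStateOnTail (h : NoRunStateOnTail) : NoLossyStrictTailsDeep :=
  noLossyStrictTailsDeep_of_lossIsFatalDeep (lossIsFatalDeep_of_stays (lossIsFatalStaysDeep_of_noRunStateOnTail h))

end Summit.ResolutionOfSingularities.ResolutionOfSingularities.Theorems.LossEpisode
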